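import Summits.ABC.IUTFork.Repair.RHTameBandLicenceSigmaAbc
import Summits.ABC.IUTFork.Repair.RHTameBandLicenceSigmaAbcRecut
import Summits.ABC.IUTFork.Repair.RHSigmaStrataEqInvariance
import Summits.ABC.IUTFork.Repair.RHSigmaLicenceInvariance
import Summits.ABC.IUTFork.Cor312ThetaSideExactK
import Summits.ABC.IUTFork.Cor312ThetaSideClosedK
import Summits.ABC.IUTFork.LDHPerPrimeReadingSlotConstant
import Summits.ABC.IUTFork.LDHInitialThetaDataPerPrime
import Summits.ABC.IUTFork.LDHSlotResiduePointPair
import Summits.ABC.IUTFork.LDHSplitPairSlackPoint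
import Summits.ABC.IUTFork.Conditional.AbcOfSHvolRefutationFixedPrime
import Literature.IUT.LogVolume.GenuineTowerDegreeBounds
import Literature.IUT.LogVolume.GenuineLogThetaPointDegrees
import HarnessLib

/-!
# R-H PAIR-5 TESTER: the [TOL] binder of row 5's abc-end `abc_of_offRemainder_sigmaFive_le_tol` is FALSE in the kernel
# (the off-Σ remainder `R_∅(T) = R_{Σ₅}(T)` grows linearly in the height along the S-unit family at a FIXED prime `l`)

PROXY-FILED by abc-iut-rh-typ-5 (gen 5) for abc-iut-rh-tst-5 (gen 4) (refuter seats cannot stage under `Repair/`), 2026-08-27. The gate's proof-file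
lint (≤ 400 lines) forces the tester's single staged file `RHOffRemainderToleranceRefutation.lean` (sha16 6609a97ef1f7db89, 757 l) to be SPLIT
VERBATIM into three files of one namespace `Summit.ABC.IUTFork.Repair.RH.OffRemainderTolerance`, no declaration changed:
`RHOffRemainderToleranceMechanism.lean` (§1–§3), `RHOffRemainderToleranceSUnit.lean` (§4), `RHOffRemainderToleranceRefutation.lean` (§5, the
refutation theorems of record). The text below is the tester's, unchanged.

abc-iut cell, rung LADDER-ABC:A2.RESCUE.H, R-H pair-5 TESTER seat abc-iut-rh-tst-5 (gen 4). PROOF-ONLY record file (D-0012: 0 definitions,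
0 `Prop` facts, 0 sorries; axioms `propext`, `Classical.choice`, `Quot.sound`). TAKES NO SIDE on [IUTchIII] Cor. 3.12, on [IUTchIV] Thm. 1.10,
or on any author: every statement is about OUR typed objects (rh2-q2-eq's defined number `RH.SigmaLicence.offRemainder` of OUR sharp
print-normalised setting `settingPrVolSharp (pilotDataOfK T.D T.K) …` at realising ideles), nothing more.

## Result
* **`not_offRemainder_sigmaFive_le_tol`** — for EVERY choice of the context functions `M, archPk, archSub, Ψ, act, Mmod, region, n, lat, sig,
  split, qData`, the [TOL] binder of abc-iut-rh2-q4-typ's `Repair.RH.TameBandLicenceSigmaAbc.abc_of_offRemainder_sigmaFive_le_tol` (p472385;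
  the same text is explicit 2 of the recut `…Recut.abc_of_offRemainder_sigmaFive_le_tol_hregBad`), VERBATIM —
  «`∀ P ∈ UP, ∀ l` prime `≥ 5`, core ∧ (P2) ∧ (P5) ∧ (P6) `→ ∀ T : ThetaVolumeDatumAt P l`, `R_{Σ₅}(T) ≤ ((l+1)/4)·5·(2¹²·3³·5·d_mod)·l`» — is FALSE.
* **`not_offRemainder_sigmaFive_le_tol_at_prime`** — already the `l`-slice is false at EVERY fixed prime `l ≥ 11`.
* **`datum_offRemainder_empty_ge`** (the mechanism, every realising idele, every context) — at a genuine Θ-volume datum `T` of the S-unit point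
  `P_{a,c}` at `l ≥ 11`: `(l(l+1)/12 − 1)·(c/l)·log 7 − (2·((l+5)/4)·(log 7 + 2·log(368640·l⁴) + 3) + log 7) ≤ R_∅(T)`.

## Mechanism (per-prime reading at the deep, slot-constant bad prime `7`; every socket by name)
`R_∅ = PN(i ↦ Σᶠ_{v_ℚ} deficit⁺(i, v_ℚ)) ≥ PN(i ↦ deficit(i, 7)) = PN(q-column at 7) − PN(Θ-column at 7)` (§1; rh2-q2-eq `offRemainder_empty_eq`,
`Cor312Vol.thetaLocal_untopD`). At the realising ideles of `pilotDataOfK T.D T.K` the q-column at `7` is `−μ`, `μ := (c/l)·log 7` the common slot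
value of the two places of `F_mod = F_{a,c}` over `7` (abc-iut-c312-e3 `qLocal_settingPrVol_qCentreDH_inr`; abc-iut-s2-p4 `ord_at_q1/q2 = −2c`,
`N𝔮 = 7`, `n_𝔮 = 1`; extension-invariance of `ord·log N/n`, abc-iut-s2-p5), and the Θ-column is EXACTLY `negLogThetaLoc_{T.I}(7)` (abc-iut-C-cert
`thetaLocal_settingPrVolSharp_pilotDataOfK_eq_sum_content_below` + `procAvg_sum_weightPr_content_below_eq_negLogThetaLoc`) (§2). abc-iut-S8's
`negLogThetaLoc_le` with `Q_7 = μ`, `κ = l(l+1)/12` (`PointDict.avgSq_eq`) and the slot-constant Step (v) bound `δ_7 ≤ |V(F_mod)_7|·((l+5)/4)·(log 7 +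
2·log[K:ℚ] + 3) + log 7` (§3: w5-d157 `explicitDeltaAt_le_of_slotConstant` + abc-iut-LDH `stepVConst_lt_of_finrank`; `|V(F_mod)_7| ≤ d_mod = 2`,
`[K:ℚ] ≤ 184320·2·l⁴`, abc-iut-L5) give §4. §5: `R_{Σ₅}(T) = R_∅(T)` (rh2-q2-eq `SigmaStrataEq.offRemainder_sigmaFive_eq_offRemainder_empty`), the
S-unit points are admissible at `l` with `c` as large as desired (abc-iut-s2-p4 `exists_exponents`, `condP2_P`, `condP5_P`, `P_mem_cbTwoDiscs` +
`Cor22.condP6_of_seven_le`), a genuine datum exists (`ThetaPartII.stub_thetaData`, PROVED), and the tolerance does not depend on `c`.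

## Classification (refuter protocol): `refuted-misstated`
The witness — a FIXED prime `l` against points of unbounded height — exploits the absence, in the binder as typed, of print's coupling of `l` to the
height ([IUTchIV] Cor. 2.2 (ii): `√(log q∀) ≤ l`, (P3)) or of a Szpiro-bad guard. REPAIRED STATEMENTS OF RECORD, both MISSED by this witness:
(C′₁) the guarded binder [TOL-bad] of `…Recut.abc_of_offRemainder_sigmaFive_le_tol_szpiroBad_hregBad` (p478095) — a generic member `P_{a,c}` is
Szpiro-GOOD (abc-iut-s2-p4 `szpiroBad_iff_log_discr_lt`: the guard is a powerful-value event for `5^{2a} + 4·7^{2c}`, not exhibitable);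
(C′₂) the windowed relative binder [ρ, WINDOW] of rh2-q2-eq's `abc_of_offRemainder_sigmaNu_rho_window` — at fixed `l` the family leaves the window
`√(log q∀) ≤ l`, and (P6) along the family is certified only on the compact discs `cbTwoDiscs (5^l)` (ineffective `HK(l)`). NOT IN SCOPE
(untouched by this file, per rh-lead g2 01:29:18Z): the CONTENT-guarded [TOL-C]/[MU-C] ends (`…_content_hregC`, p476943 family; F4½ p481829; F5),
the Szpiro-bad-guarded recuts, the window / ρ / pilot-gap / weighted-mass carriers — each carries a guard or a coupling this witness does not meet;
whether an unguarded ∀-T binder elsewhere is hit is decided by the one-line test `example : ¬⟨binder⟩ := not_offRemainder_sigmaFive_le_tol …`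
(or by `not_offRemainder_sigmaFive_le_tol_at_prime` + a strata identity `R_Σ(T) = R_∅(T)`), not asserted here. HONEST CAVEAT, an
observation not a theorem: the mechanism is structural — at every prime of `𝕍^bad_mod` the typed deficit is `≈ (l(l+1)/12 − 1)·μ_p − δ_p`, so
`R_∅(T) ≳ (l/12)·(normalised log q^bad) − C(l)` at EVERY datum; any tolerance `O(l²)` uniform in the height is exceeded once `log q ≫ l`.

HONEST FRAMING: «these typed hypotheses are unsatisfiable / this binder is false AS TYPED», nothing more; nothing here asserts that abc is proved or
refuted, or that [IUTchIII] Cor. 3.12 holds or fails at any datum; typed ≠ proved; instantiated ≠ endorsed.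
[cite: Mochizuki2012, IUTchIV Thm. 1.10 pp. 22–31, Step (v) pp. 27–28; Cor. 2.2 (ii)–(iii) pp. 41–48] [cite: Mochizuki2012, IUTchIII Cor. 3.12 p. 174]
[cite: DupuyHilado2025, §3.3, §3.6, §4.7, §4.12] [claim: Mochizuki2012, status: disputed] for every IUT quotation.
-/


noncomputable section

open Set Function NumberField IsDedekindDomain
open scoped Pointwise

namespace Summit.ABC.IUTFork.Repair.RH.OffRemainderTolerance

open Summit.ABC.IUTFork.Thm311 Summit.ABC.IUTFork.Thm311.Real Summit.ABC.IUTFork.Cor312 Summit.ABC.IUTFork.Cor312.Setting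
  Summit.ABC.IUTFork.Cor312Vol Summit.ABC.IUTFork.Cor312Prov Summit.ABC.IUTFork.Repair.RH.SigmaLicence
  Literature.IUT.LogThetaLattice Literature.IUT.LogVolume Literature.IUT.HodgeTheaters Literature.NumberTheory.NumberFields

/-! ## §1. Setting level: one packet column bounds `R_∅` from below -/

section SettingLevel

variable {T : ThetaIndex} {S : Situation T} {P : Cor312.Setting S}

/-- `PN(i ↦ deficit(i, v_ℚ)) ≤ R_∅` for every single `v_ℚ`: `R_∅ = PN(i ↦ Σᶠ_{v_ℚ'} deficit⁺(i, v_ℚ'))` (rh2-q2-eq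
`offRemainder_empty_eq`), one non-negative term of a finitely supported sum is at most the sum, and `deficit ≤ deficit⁺`.
[claim: Mochizuki2012, status: disputed] -/
theorem processionNormalized_cellDeficit_le_offRemainder_empty (H : BridgeHyps P) (vQ : T.VQ) :
    processionNormalized (fun i : Fin T.lstar => cellDeficit P i vQ) ≤ offRemainder P ∅ := by
  rw [offRemainder_empty_eq]
  unfold processionNormalized
  refine div_le_div_of_nonneg_right (Finset.sum_le_sum fun i _ => ?_) (Nat.cast_nonneg _)
  have hfin : (Function.support fun vQ' : T.VQ => max (cellDeficit P i vQ') 0).Finite := by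
    simpa only [Set.compl_empty, Set.indicator_univ] using indicator_deficit_support_finite H ∅ i
  exact (le_max_left _ _).trans (single_le_finsum vQ hfin fun _ => le_max_right _ _)

/-- `PN(i ↦ deficit(i, v_ℚ)) = PN(i ↦ qLocal_{i+1,v_ℚ}) − PN(i ↦ (−|log(Θ)|_{i+1,v_ℚ}).untopD 0)` under the bridge hypotheses
(`deficit = qLocal − logvol(hull)`, abc-iut-w5's `thetaLocal_untopD`). [claim: Mochizuki2012, status: disputed] -/
theorem processionNormalized_cellDeficit_eq (H : BridgeHyps P) (vQ : T.VQ) :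
    processionNormalized (fun i : Fin T.lstar => cellDeficit P i vQ) =
      processionNormalized (fun i : Fin T.lstar => P.qLocal (labelSucc i) vQ) -
        processionNormalized (fun i : Fin T.lstar => (P.thetaLocal (labelSucc i) vQ).untopD 0) := by
  unfold processionNormalized cellDeficit
  rw [← sub_div, ← Finset.sum_sub_distrib]
  congr 1
  refine Finset.sum_congr rfl fun i _ => ?_
  rw [thetaLocal_untopD H i vQ]

end SettingLevel

/-! ## §2. `K` level (realising ideles): `R_∅ ≥ −μ_p − negLogThetaLoc_I(p)` at a prime `p` where the q-pilot is pure of slope `μ_p` -/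

section KLevel

variable {F K Fbar : Type} [Field F] [NumberField F] [Field K] [NumberField K] [Algebra F K] [Field Fbar]
  [Algebra F Fbar] [Algebra K Fbar] {E : WeierstrassCurve F} [E.IsElliptic] {l : ℕ} {Pb : BadPlacePredicates K}
  (D : InitialThetaData F K Fbar E l Pb)
  (M : Type) [Field M] [NumberField M]
  (archPk : ∀ (j : (thetaIndex (pilotDataOfK D K)).Label) (vQ : (thetaIndex (pilotDataOfK D K)).VQ),
    Set ((logShellsDH (pilotDataOfK D K) (analyticLogv K)).Packet j vQ))
  (archSub : ∀ (j : (thetaIndex (pilotDataOfK D K)).Label) (v : (thetaIndex (pilotDataOfK D K)).V),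
    Set ((logShellsDH (pilotDataOfK D K) (analyticLogv K)).Packet j ((thetaIndex (pilotDataOfK D K)).over v)))
  (Ψ : ℤ → ∀ v : (thetaIndex (pilotDataOfK D K)).V, v ∈ (thetaIndex (pilotDataOfK D K)).Vbad →
    Set ((logShellsDH (pilotDataOfK D K) (analyticLogv K)).StarPacket v))
  (act : ℤ → ∀ v : (thetaIndex (pilotDataOfK D K)).V, v ∈ (thetaIndex (pilotDataOfK D K)).Vbad →
    (logShellsDH (pilotDataOfK D K) (analyticLogv K)).StarPacket v →
      Module.End ℚ ((logShellsDH (pilotDataOfK D K) (analyticLogv K)).StarPacket v))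
  (Mmod : ℤ → ∀ j : (thetaIndex (pilotDataOfK D K)).LabelStar,
    Set ((logShellsDH (pilotDataOfK D K) (analyticLogv K)).GlobalPacket j.1))
  (region : ℤ → ∀ j : (thetaIndex (pilotDataOfK D K)).LabelStar, FinDivisor M → ∀ vQ : (thetaIndex (pilotDataOfK D K)).VQ,
    Set ((logShellsDH (pilotDataOfK D K) (analyticLogv K)).Packet j.1 vQ))
  (n : ℤ) {HT : Type} {LogLink : HT → HT → Type} {IsFull : ∀ {s t : HT}, LogLink s t → Prop}
  (lat : LGPGaussianLogThetaLattice LogLink IsFull)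
  {Frd : Type} {IsoF : Frd → Frd → Type} {Ob : Frd → Type} {realify : Frd → Frd} {Strip : Type}
  {IsoS : Strip → Strip → Type}
  {Mv : ∀ v : (thetaIndex (pilotDataOfK D K)).V, v ∈ (thetaIndex (pilotDataOfK D K)).Vbad → Type} [∀ v h, Monoid (Mv v h)]
  (sig : GlobalLGPFrobenioidSignature (thetaIndex (pilotDataOfK D K)).lstar (thetaIndex (pilotDataOfK D K)).V
    (· ∈ (thetaIndex (pilotDataOfK D K)).Vbad) Frd IsoF Ob realify Strip IsoS Mv)
  (split : SplittingMonoids Mv) {ObΔ : Type}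
  {N : ∀ v : (thetaIndex (pilotDataOfK D K)).V, v ∈ (thetaIndex (pilotDataOfK D K)).Vbad → Type} [∀ v h, Monoid (N v h)]
  (qData : QPilotData ObΔ N)
  (tq : ∀ (pp : Nat.Primes) (x : (thetaIndex (pilotDataOfK D K)).Fibre (.inr pp)),
    haveI : Fact (pp : ℕ).Prime := ⟨pp.2⟩; kOf (pilotDataOfK D K) pp.1 x)
  (t : ∀ (pp : Nat.Primes) (_ : Fin (pilotDataOfK D K).lstar) (x : (thetaIndex (pilotDataOfK D K)).Fibre (.inr pp)),
    haveI : Fact (pp : ℕ).Prime := ⟨pp.2⟩; kOf (pilotDataOfK D K) pp.1 x)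
  (htq0 : ∀ pp x, tq pp x ≠ 0)
  (htq1 : ∀ (pp : Nat.Primes) (x : (thetaIndex (pilotDataOfK D K)).Fibre (.inr pp)),
    haveI : Fact (pp : ℕ).Prime := ⟨pp.2⟩; placeOf (pilotDataOfK D K) pp.1 x ∉ (pilotDataOfK D K).S → ‖tq pp x‖ = 1)
  (ht0 : ∀ pp i x, t pp i x ≠ 0)
  (ht : ∀ (pp : Nat.Primes) (i : Fin (pilotDataOfK D K).lstar) (x : (thetaIndex (pilotDataOfK D K)).Fibre (.inr pp)),
    haveI : Fact (pp : ℕ).Prime := ⟨pp.2⟩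
    Real.log ‖t pp i x‖ = -((pilotDataOfK D K).thetaPilot i (placeOf (pilotDataOfK D K) pp.1 x)) *
      logNorm K (placeOf (pilotDataOfK D K) pp.1 x) / localDegree K (placeOf (pilotDataOfK D K) pp.1 x))
  (htq : ∀ (pp : Nat.Primes) (x : (thetaIndex (pilotDataOfK D K)).Fibre (.inr pp)),
    haveI : Fact (pp : ℕ).Prime := ⟨pp.2⟩
    Real.log ‖tq pp x‖ = -((pilotDataOfK D K).qPilot (placeOf (pilotDataOfK D K) pp.1 x)) *
      logNorm K (placeOf (pilotDataOfK D K) pp.1 x) / localDegree K (placeOf (pilotDataOfK D K) pp.1 x))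

include htq in
/-- **The local q-volume at a prime of PURE SLOPE.** If `P_q(w)·log N(w) = μ·n_w` at every place `w | p` of `K`, then
`qLocal_{j,p} = −μ` for every label `j` (abc-iut-c312-7's closed form `−(1/[K:ℚ])·Σ_{w|p} P_q(w)·log N(w)` and `Σ_{w|p} n_w = [K:ℚ]`).
[cite: DupuyHilado2025, §3.4, §3.6, Thm. 3.10.1] -/
theorem qLocal_settingPrVolSharp_inr_eq_neg_of_slope (pp : Nat.Primes) (μ : ℝ)
    (hμ : haveI : Fact (pp : ℕ).Prime := ⟨pp.2⟩
      ∀ w ∈ placesOver K pp, (pilotDataOfK D K).qPilot w * logNorm K w = μ * localDegree K w)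
    (j : (thetaIndex (pilotDataOfK D K)).Label) :
    (settingPrVolSharp (pilotDataOfK D K) (logvAnalytic_analyticLogv (F := K)) M archPk archSub Ψ act Mmod region n lat sig split
        qData tq t htq0 htq1).qLocal j (.inr pp) = -μ := by
  haveI : Fact (pp : ℕ).Prime := ⟨pp.2⟩
  unfold settingPrVolSharp
  rw [qLocal_settingPrVol_qCentreDH_inr (pilotDataOfK D K) (logvAnalytic_analyticLogv (F := K)) M archPk archSub Ψ act Mmod region n
    lat sig split qData _ tq htq0 _ htq j pp]
  have hsum : ∑ v ∈ placesOver K pp, -((pilotDataOfK D K).qPilot v) * logNorm K v = -μ * (Module.finrank ℚ K : ℝ) := by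
    rw [← sum_localDegree K (pp : ℕ), Nat.cast_sum, Finset.mul_sum]
    exact Finset.sum_congr rfl fun v hv => by rw [neg_mul, hμ v hv, neg_mul]
  rw [hsum, mul_div_assoc, div_self (ne_of_gt FinDivisor.finrank_pos), mul_one]

include ht0 ht htq in
/-- **PER-PRIME LOWER BOUND FOR THE TOTAL OFF-Σ REMAINDER `R_∅` (realising ideles).** For a genuine Θ-volume input `I` of the
initial Θ-data `D`, a support prime `p ∈ T(I)` at which the q-pilot of `K` is pure of slope `μ` (`P_q(w)·log N(w) = μ·n_w` for all `w | p`):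
`−μ − negLogThetaLoc_I(p) ≤ R_∅(settingPrVolSharp (pilotDataOfK D K) … t_q t)`. Chain: `R_∅ ≥ PN(i ↦ deficit(i,p))` (§1) `=
PN(qLocal_{·,p}) − PN(−|log(Θ)|_{·,p}) = −μ − negLogThetaLoc_I(p)` — the Θ-column is EXACT at realising Θ-ideles (abc-iut-s2-p7
`thetaLocal_settingPrVolSharp_pilotDataOfK_eq_sum_content_below` + abc-iut-ClosedK `procAvg_sum_weightPr_content_below_eq_negLogThetaLoc`).
[cite: Mochizuki2012, IUTchIV Thm. 1.10 Step (v) p. 27–28] [cite: DupuyHilado2025, §3.4, §4.12] [claim: Mochizuki2012, status: disputed] -/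
theorem neg_slope_sub_negLogThetaLoc_le_offRemainder_empty {I : ThetaVolumeInput (fieldOfModuli E) K}
    (hI : ThetaData.IsVolumeInputOf D I) (pp : Nat.Primes) (hpp : (pp : ℕ) ∈ I.supportPrimes) (μ : ℝ)
    (hμ : haveI : Fact (pp : ℕ).Prime := ⟨pp.2⟩
      ∀ w ∈ placesOver K pp, (pilotDataOfK D K).qPilot w * logNorm K w = μ * localDegree K w) :
    -μ - I.negLogThetaLoc pp ≤
      offRemainder (settingPrVolSharp (pilotDataOfK D K) (logvAnalytic_analyticLogv (F := K)) M archPk archSub Ψ act Mmod region n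
        lat sig split qData tq t htq0 htq1) ∅ := by
  haveI : Fact (pp : ℕ).Prime := ⟨pp.2⟩
  obtain ⟨r, rfl⟩ := ThetaData.exists_eq_volumeInputOf D hI
  obtain ⟨mgen, hmgen⟩ := (ThetaData.volumeInputOf D r).exists_contentFamily
  have ht1 := fun pp i x hx => norm_eq_one_of_realises (pilotDataOfK D K) t ht0 ht pp i x hx
  have HB : BridgeHyps (settingPrVolSharp (pilotDataOfK D K) (logvAnalytic_analyticLogv (F := K)) M archPk archSub Ψ act Mmod
      region n lat sig split qData tq t htq0 htq1) :=
    bridgeHyps_settingPrVolSharp_of_ideles (pilotDataOfK D K) (logvAnalytic_analyticLogv (F := K)) M archPk archSub Ψ act Mmod region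
      n lat sig split qData t tq ht0 ht1 htq0 htq1
  refine le_trans (le_of_eq ?_) (processionNormalized_cellDeficit_le_offRemainder_empty HB (.inr pp))
  rw [processionNormalized_cellDeficit_eq HB]
  have hq : processionNormalized (fun i : Fin (thetaIndex (pilotDataOfK D K)).lstar =>
      (settingPrVolSharp (pilotDataOfK D K) (logvAnalytic_analyticLogv (F := K)) M archPk archSub Ψ act Mmod region n lat sig split
        qData tq t htq0 htq1).qLocal (labelSucc i) (.inr pp)) = -μ := by
    have hfun : (fun i : Fin (thetaIndex (pilotDataOfK D K)).lstar =>
        (settingPrVolSharp (pilotDataOfK D K) (logvAnalytic_analyticLogv (F := K)) M archPk archSub Ψ act Mmod region n lat sig split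
          qData tq t htq0 htq1).qLocal (labelSucc i) (.inr pp)) = fun _ => -μ :=
      funext fun i => qLocal_settingPrVolSharp_inr_eq_neg_of_slope D M archPk archSub Ψ act Mmod region n lat sig split qData tq t
        htq0 htq1 htq pp μ hμ (labelSucc i)
    rw [hfun]
    exact processionNormalized_const (lt_of_lt_of_le two_pos (pilotDataOfK D K).two_le_lstar) _
  have hθ : processionNormalized (fun i : Fin (thetaIndex (pilotDataOfK D K)).lstar =>
      ((settingPrVolSharp (pilotDataOfK D K) (logvAnalytic_analyticLogv (F := K)) M archPk archSub Ψ act Mmod region n lat sig split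
        qData tq t htq0 htq1).thetaLocal (labelSucc i) (.inr pp)).untopD 0) = (ThetaData.volumeInputOf D r).negLogThetaLoc pp := by
    rw [← procAvg_sum_weightPr_content_below_eq_negLogThetaLoc D r pp hpp mgen hmgen]
    unfold processionNormalized
    rw [one_div_mul_eq_div]
    simp only [thetaLocal_settingPrVolSharp_pilotDataOfK_eq_sum_content_below D r M archPk archSub Ψ act Mmod region n lat sig split
      qData tq t htq0 htq1 mgen hmgen ht0 ht pp hpp, WithTop.untopD_coe]
  rw [hq, hθ]

end KLevel

/-! ## §3. The `ord(q)`-free Step (v) constant against `[K:ℚ]`, summed over the places over `p` -/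

section SlotConstant

variable {F₀ K : Type} [Field F₀] [NumberField F₀] [Field K] [NumberField K] [Algebra F₀ K]

/-- **At a slot-constant prime the Step (v) discrepancy is bounded by `|V(F₀)_p|·((ℓ⋆+3)/2)·(log p + 2·log[K:ℚ] + 3) + log p`**
(w5-d157's `explicitDeltaAt_le_of_slotConstant` + abc-iut-LDH's per-place `stepVConst_lt_of_finrank`, summed over `v | p`).
[cite: Mochizuki2012, IUTchIV Thm. 1.10 Step (v) p. 27–28] [cite: SerreLocalFields1979, Ch. III §6 Prop. 13] -/
theorem explicitDeltaAt_le_card_mul_of_slotConstant (I : ThetaVolumeInput F₀ K) {p : ℕ} [hpi : Fact p.Prime]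
    (hconst : ∀ i : Fin I.X.lstar, ∃ c : ℝ, ∀ v : placesOver F₀ p,
      I.X.thetaPilot i v.1 * logNorm F₀ v.1 / localDegree F₀ v.1 = c) :
    DHData.explicitDeltaAt I p ≤
      (Fintype.card (placesOver F₀ p) : ℝ) *
          (((I.X.lstar : ℝ) + 3) / 2 * (Real.log p + 2 * Real.log (Module.finrank ℚ K) + 3)) + Real.log p := by
  refine (DHData.explicitDeltaAt_le_of_slotConstant I hconst).trans ?_
  have hv : ∀ v : placesOver F₀ p,
      ((I.X.lstar : ℝ) + 3) / 2 * differentOrd p ((I.σ.localFieldFamily p hpi.out).k v) * Real.log p +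
          ((I.X.lstar : ℝ) + 3) / 2 * (3 + Real.log (absRamificationIdx p ((I.σ.localFieldFamily p hpi.out).k v))) ≤
        ((I.X.lstar : ℝ) + 3) / 2 * (Real.log p + 2 * Real.log (Module.finrank ℚ K) + 3) := by
    intro v
    have h := ThetaVolumeInput.stepVConst_lt_of_finrank I v
    have hexp : (((I.X.lstar : ℝ) + 3) / 2 * differentOrd p ((I.σ.localFieldFamily p hpi.out).k v) + 1) * Real.log p =
        ((I.X.lstar : ℝ) + 3) / 2 * differentOrd p ((I.σ.localFieldFamily p hpi.out).k v) * Real.log p + Real.log p := by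
      ring
    linarith
  have h1 : (((I.X.lstar : ℝ) + 3) / 2 * (∑ v : placesOver F₀ p, differentOrd p ((I.σ.localFieldFamily p hpi.out).k v)) + 1) *
        Real.log p =
      (∑ v : placesOver F₀ p, ((I.X.lstar : ℝ) + 3) / 2 * differentOrd p ((I.σ.localFieldFamily p hpi.out).k v) * Real.log p) +
        Real.log p := by
    rw [add_mul, one_mul, Finset.mul_sum, Finset.sum_mul]
  have h2 : ((I.X.lstar : ℝ) + 3) / 2 *
        ∑ v : placesOver F₀ p, (3 + Real.log (absRamificationIdx p ((I.σ.localFieldFamily p hpi.out).k v))) =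
      ∑ v : placesOver F₀ p, ((I.X.lstar : ℝ) + 3) / 2 * (3 + Real.log (absRamificationIdx p ((I.σ.localFieldFamily p hpi.out).k v))) :=
    Finset.mul_sum _ _ _
  have h3 := Finset.sum_le_sum fun v (_ : v ∈ (Finset.univ : Finset (placesOver F₀ p))) => hv v
  rw [Finset.sum_add_distrib, Finset.sum_const, Finset.card_univ, nsmul_eq_mul] at h3
  rw [h1, h2]
  linarith

end SlotConstant

end Summit.ABC.IUTFork.Repair.RH.OffRemainderTolerance

end
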